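import Literature.Analysis.FluidPDE.PeriodicLerayTransportIntegrability
import HarnessLib

/-!
# [BT1] §4 ¶1–3, the transport of suitable periodic weak solutions, V: the distributional
  Navier–Stokes equations, the energy class and the pressure class on the slab

Analysis/FluidPDE proof file (theorems only), fifth part of the discharge of the named fact
`Literature.Analysis.FluidPDE.bradshawTsai2017_ansatz_transport` (`PeriodicLeraySystem.lean`;
Bradshaw–Tsai, Ann. Henri Poincaré 18 (2017) = arXiv:1510.07504 [BT1], §4, proof of Thm 1.2),
continuing `PeriodicLerayTransport`, `PeriodicLerayTransportGradient` and
`PeriodicLerayTransportIntegrability`.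

[BT1] §4 ¶1: "Let `v(x,t) = u(y,s)/√(2t)` and `π(x,t) = p(y,s)/2t` where `y = x/√(2t)` and
`s = log(√(2t))`. Then `(v,π)` is a distributional solution to (NSE). Indeed, if we let
`ζ(x,t) = f(y,s)/(2t)` where `f(y,s)` is the test vector in the weak form of the `u`-equation, and
note that `∂ₜζ(x,t) = (2t)⁻²(∂ₛ − 2 − y·∇_y)f(y,s)`, we recover the weak form of the
Navier–Stokes equations for `v` with test vector `ζ` from the weak form for `u`."

Read backwards (`f = e^{2s} ζ ∘ Φ`, `Φ(s,y) = (e^{2s}/2, eˢy)`, `dt dx = e^{5s} ds dy`, toolkit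
`SimilarityVariables`): for a test field `ζ ∈ C_c^∞((0,∞) × ℝ³; ℝ³)` the pulled-back integrand
`e^{5s}[v·∂ₜζ + v·(v·∇)ζ + v·Δζ + π div ζ](Φ(s,y))` **equals pointwise** the integrand
`u·(∂ₛf + Δf − 2f − (y·∇)f) + u·(u·∇)f + p div f` of the distributional form of the Leray system
(2.1) ([BT1] Def. 2.3, the tree's `IsSuitablePeriodicWeakSolution.distributional`) — the terms
`2e^{2s} u·ζ(Φ)` and `e^{2s} u·D_xζ(Φ)[eˢy]` produced by `∂ₛ(e^{2s} ζ ∘ Φ)` cancel against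
`−2f − (y·∇_y)f` (`simDensity_mul_nse_integrand`). No integrability is needed: the change of
variables holds for the Bochner integral unconditionally. This file proves:

* chain rules for `f = e^{2s} ζ ∘ Φ` (`timeDeriv`, `D_y`, `(a·∇_y)`, `div_y`, `Δ_y`);
* `IsSuitablePeriodicWeakSolution.isDistributionalNSSolutionOn_phys`: **`(v, π)` is a
  distributional solution of Navier–Stokes (`ν = 1`, `f = 0`) on the slab `t > 0`** (local
  integrability of `v`, `|v|²`, `π` on the slab by the change of variables on compact sets; weak
  divergence-freeness from `∇·u = 0` slice-wise and Fubini; the momentum equation as above);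
* `IsSuitablePeriodicWeakSolution.energyClass_phys`: `v ∈ L^∞_t L²_x` on compact subsets of the
  slab (`|v|² ≤ 2|v − e^{tΔ}v₀… |²`-type splitting `v = (v − V₀) + V₀` with
  `V₀ = physVelocity U₀` continuous on the slab and `∫|v(t) − V₀(t)|² = √(2t) ∫|u(s) − U₀(s)|²`);
* `IsSuitablePeriodicWeakSolution.pressure_threeHalves_phys`: `π ∈ L^{3/2}_loc` on the slab
  (`p ∈ L^{3/2}_loc(ℝ⁴)`, Def. 2.3, and the change of variables on compact sets).

## References

* Z. Bradshaw, T.-P. Tsai, Ann. Henri Poincaré 18 (2017) = arXiv:1510.07504, Def. 2.2–2.3, §4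
  (proof of Thm 1.2) ¶1 and Remark 4.1 [BradshawTsai2017AHP].
* L. Caffarelli, R. Kohn, L. Nirenberg, CPAM 35 (1982), (2.1)–(2.3) [CaffarelliKohnNirenberg1982].
-/

noncomputable section

open MeasureTheory TopologicalSpace Set Function Filter Topology Module Metric
open scoped InnerProductSpace RealInnerProductSpace ENNReal NNReal Laplacian

namespace Literature.Analysis.FluidPDE

namespace BradshawTsai2017

variable {T : ℝ} {q : ℝ≥0∞}
  {U₀ u : ℝ → EuclideanSpace ℝ (Fin 3) → EuclideanSpace ℝ (Fin 3)}
  {p : ℝ → EuclideanSpace ℝ (Fin 3) → ℝ}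

/-! ### The weighted pull-back `f = e^{2s} ζ ∘ Φ` of a test field and its derivatives -/

section ChainRules

variable {ζ : ℝ → EuclideanSpace ℝ (Fin 3) → EuclideanSpace ℝ (Fin 3)}

/-- The test field `f(s,y) = e^{2s} ζ(Φ(s,y))` of [BT1] §4 ("`ζ(x,t) = f(y,s)/(2t)`") is a
space–time test field on `ℝ × ℝ³` when `ζ ∈ C_c^∞((0,∞) × ℝ³; ℝ³)`. [cite: BradshawTsai2017AHP, §4 (proof of Thm 1.2)] -/
theorem isSpaceTimeTestOn_expTwo_smul_simPull
    (hζ : IsSpaceTimeTestOn (slab (EuclideanSpace ℝ (Fin 3)) (Ioi 0) isOpen_Ioi) ζ) :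
    IsSpaceTimeTestOn (⊤ : Opens (ℝ × EuclideanSpace ℝ (Fin 3)))
      (fun s y => Real.exp (2 * s) • simPull ζ s y) :=
  hζ.time_smul_simPull (Real.contDiff_exp.comp (contDiff_const.mul contDiff_id))

/-- `d/ds e^{2s} = 2 e^{2s}`. [folklore] -/
theorem hasDerivAt_exp_two_mul (s : ℝ) :
    HasDerivAt (fun r => Real.exp (2 * r)) (2 * Real.exp (2 * s)) s := by
  have h := ((hasDerivAt_id s).const_mul (2 : ℝ)).exp
  simp only [id_eq, mul_one] at h
  rwa [mul_comm] at h

/-- **Chain rule in time for `f = e^{2s} ζ ∘ Φ`** ([BT1] §4: "`∂ₜζ = (2t)⁻²(∂ₛ − 2 − y·∇_y)f`"):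
`∂ₛf(s,y) = e^{2s}(e^{2s} ∂ₜζ(Φ) + D_xζ(Φ)[eˢy]) + 2e^{2s} ζ(Φ)`. [cite: BradshawTsai2017AHP, §4 (proof of Thm 1.2)] -/
theorem timeDeriv_expTwo_smul_simPull
    (hζ : IsSpaceTimeTestOn (slab (EuclideanSpace ℝ (Fin 3)) (Ioi 0) isOpen_Ioi) ζ) (s : ℝ)
    (y : EuclideanSpace ℝ (Fin 3)) :
    timeDeriv (fun s y => Real.exp (2 * s) • simPull ζ s y) s y =
      Real.exp (2 * s) • (Real.exp (2 * s) • timeDeriv ζ (simTime s) (Real.exp s • y) +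
          fderiv ℝ (ζ (simTime s)) (Real.exp s • y) (Real.exp s • y)) +
        (2 * Real.exp (2 * s)) • simPull ζ s y := by
  have hd : DifferentiableAt ℝ (uncurry ζ) (simMap (s, y)) :=
    ((hζ.contDiff.differentiable (by simp)).differentiableAt)
  have hg : HasDerivAt (fun r => simPull ζ r y) _ s := hasDerivAt_simPull hd.hasFDerivAt
  rw [timeDeriv_apply, deriv_fun_smul (hasDerivAt_exp_two_mul s).differentiableAt
    hg.differentiableAt, (hasDerivAt_exp_two_mul s).deriv, ← timeDeriv_apply (simPull ζ) s y,
    timeDeriv_simPull hd]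

/-- **Chain rule in space for `f = e^{2s} ζ ∘ Φ`**: `D_yf(s,·)(y) = e^{2s} eˢ D_xζ(Φ(s,y))`. [folklore] -/
theorem fderiv_expTwo_smul_simPull
    (hζ : IsSpaceTimeTestOn (slab (EuclideanSpace ℝ (Fin 3)) (Ioi 0) isOpen_Ioi) ζ) (s : ℝ)
    (y : EuclideanSpace ℝ (Fin 3)) :
    fderiv ℝ ((fun s y => Real.exp (2 * s) • simPull ζ s y) s) y =
      (Real.exp (2 * s) * Real.exp s) • fderiv ℝ (ζ (simTime s)) (Real.exp s • y) := by
  have hd : DifferentiableAt ℝ (simPull ζ s) y :=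
    ((hζ.simPull.contDiff_slice s).differentiable (by simp)).differentiableAt
  show fderiv ℝ (fun y' => Real.exp (2 * s) • simPull ζ s y') y = _
  rw [fderiv_fun_const_smul hd, fderiv_simPull, smul_smul]

/-- The convective derivative of `f = e^{2s} ζ ∘ Φ` along a field `a`:
`((a·∇_y)f)(s,y) = e^{2s} eˢ D_xζ(Φ(s,y))[a(y)]`. [folklore] -/
theorem convect_expTwo_smul_simPull
    (hζ : IsSpaceTimeTestOn (slab (EuclideanSpace ℝ (Fin 3)) (Ioi 0) isOpen_Ioi) ζ)
    (a : EuclideanSpace ℝ (Fin 3) → EuclideanSpace ℝ (Fin 3)) (s : ℝ)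
    (y : EuclideanSpace ℝ (Fin 3)) :
    convect a ((fun s y => Real.exp (2 * s) • simPull ζ s y) s) y =
      (Real.exp (2 * s) * Real.exp s) • fderiv ℝ (ζ (simTime s)) (Real.exp s • y) (a y) := by
  rw [convect_apply, fderiv_expTwo_smul_simPull hζ]
  rfl

/-- The divergence of `f = e^{2s} ζ ∘ Φ`: `div_y f(s,y) = e^{2s} eˢ div_x ζ(Φ(s,y))`. [folklore] -/
theorem divergence_expTwo_smul_simPull
    (hζ : IsSpaceTimeTestOn (slab (EuclideanSpace ℝ (Fin 3)) (Ioi 0) isOpen_Ioi) ζ) (s : ℝ)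
    (y : EuclideanSpace ℝ (Fin 3)) :
    VectorCalculus.divergence ((fun s y => Real.exp (2 * s) • simPull ζ s y) s) y =
      Real.exp (2 * s) * Real.exp s *
        VectorCalculus.divergence (ζ (simTime s)) (Real.exp s • y) := by
  rw [VectorCalculus.divergence, VectorCalculus.divergence, fderiv_expTwo_smul_simPull hζ,
    ContinuousLinearMap.toLinearMap_smul, LinearMap.map_smul, smul_eq_mul]

/-- The Laplacian of `f = e^{2s} ζ ∘ Φ`: `Δ_y f(s,·)(y) = e^{2s} e^{2s} Δ_x ζ(Φ(s,y))`. [folklore] -/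
theorem laplacian_expTwo_smul_simPull
    (hζ : IsSpaceTimeTestOn (slab (EuclideanSpace ℝ (Fin 3)) (Ioi 0) isOpen_Ioi) ζ) (s : ℝ)
    (y : EuclideanSpace ℝ (Fin 3)) :
    (Δ ((fun s y => Real.exp (2 * s) • simPull ζ s y) s)) y =
      Real.exp (2 * s) • (Real.exp (2 * s) • (Δ (ζ (simTime s))) (Real.exp s • y)) := by
  have h2 : ContDiff ℝ 2 (simPull ζ s) := (hζ.simPull).contDiff_slice_two s
  have e : ((fun s y => Real.exp (2 * s) • simPull ζ s y) s) = Real.exp (2 * s) • simPull ζ s := by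
    funext y'; rfl
  rw [e, InnerProductSpace.laplacian_smul (Real.exp (2 * s)) h2.contDiffAt,
    laplacian_simPull _ _ _ (hζ.contDiff_slice_two _)]

end ChainRules

/-! ### The pointwise identity of the momentum integrands -/

/-- **The momentum integrand under the ansatz** ([BT1] §4 ¶1, read backwards): with
`v(Φ) = e^{-s}u`, `π(Φ) = e^{-2s}p`, `f = e^{2s} ζ ∘ Φ`, for every `(s,y)`,
`e^{5s}[⟪v,∂ₜζ⟫ + ⟪v,(v·∇)ζ⟫ + 1·⟪v,Δζ⟫ + π div ζ + ⟪0,ζ⟫](Φ(s,y))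
 = ⟪u, ∂ₛf⟫ + ⟪u, Δf⟫ − ⟪u, 2f + (y·∇)f⟫ + ⟪u, (u·∇)f⟫ + p div f` — the integrand of the
distributional form of (2.1). [cite: BradshawTsai2017AHP, §4 (proof of Thm 1.2) ¶1 and Remark 4.1] -/
theorem simDensity_mul_nse_integrand {ζ : ℝ → EuclideanSpace ℝ (Fin 3) → EuclideanSpace ℝ (Fin 3)}
    (hζ : IsSpaceTimeTestOn (slab (EuclideanSpace ℝ (Fin 3)) (Ioi 0) isOpen_Ioi) ζ)
    (u : ℝ → EuclideanSpace ℝ (Fin 3) → EuclideanSpace ℝ (Fin 3))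
    (p : ℝ → EuclideanSpace ℝ (Fin 3) → ℝ) (s : ℝ) (y : EuclideanSpace ℝ (Fin 3)) :
    (simDensity (EuclideanSpace ℝ (Fin 3)) (s, y) : ℝ) *
        (⟪physVelocity u (simTime s) (Real.exp s • y), timeDeriv ζ (simTime s) (Real.exp s • y)⟫ +
          ⟪physVelocity u (simTime s) (Real.exp s • y),
            convect (physVelocity u (simTime s)) (ζ (simTime s)) (Real.exp s • y)⟫ +
          1 * ⟪physVelocity u (simTime s) (Real.exp s • y),
            (Δ (ζ (simTime s))) (Real.exp s • y)⟫ +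
          physPressure p (simTime s) (Real.exp s • y) *
            VectorCalculus.divergence (ζ (simTime s)) (Real.exp s • y) +
          ⟪(0 : ℝ → EuclideanSpace ℝ (Fin 3) → EuclideanSpace ℝ (Fin 3)) (simTime s)
            (Real.exp s • y), ζ (simTime s) (Real.exp s • y)⟫) =
      ⟪u s y, timeDeriv (fun s y => Real.exp (2 * s) • simPull ζ s y) s y⟫ +
        ⟪u s y, (Δ ((fun s y => Real.exp (2 * s) • simPull ζ s y) s)) y⟫ -
        ⟪u s y, (2 : ℝ) • (fun s y => Real.exp (2 * s) • simPull ζ s y) s y +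
          fderiv ℝ ((fun s y => Real.exp (2 * s) • simPull ζ s y) s) y y⟫ +
        ⟪u s y, convect (u s) ((fun s y => Real.exp (2 * s) • simPull ζ s y) s) y⟫ +
        p s y * VectorCalculus.divergence ((fun s y => Real.exp (2 * s) • simPull ζ s y) s) y := by
  rw [timeDeriv_expTwo_smul_simPull hζ, laplacian_expTwo_smul_simPull hζ,
    fderiv_expTwo_smul_simPull hζ, convect_expTwo_smul_simPull hζ,
    divergence_expTwo_smul_simPull hζ, coe_simDensity_three, convect_apply, physVelocity_simMap,
    physPressure_simMap]
  have h5 : Real.exp (5 * s) = Real.exp s ^ 5 := by rw [← Real.exp_nat_mul]; norm_num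
  have h2 : Real.exp (2 * s) = Real.exp s ^ 2 := by rw [← Real.exp_nat_mul]; norm_num
  simp only [simPull_apply, Pi.zero_apply, inner_zero_left, add_zero, map_smul,
    FunLike.coe_smul, Pi.smul_apply, inner_add_right, inner_smul_right,
    real_inner_smul_left, h5, h2]
  have hE : Real.exp s ≠ 0 := (Real.exp_pos s).ne'
  field_simp
  ring

/-! ### Local integrability on the slab -/

section Classes

/-- **`|v|² ∈ L¹_loc` on the slab** from `|u|² ∈ L¹_loc(ℝ × ℝ³)` (`|v(z)|² = (2t)⁻¹ |u(Φ⁻¹z)|²`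
and the change of variables on compact subsets of the slab). [cite: BradshawTsai2017AHP, §4 (proof of Thm 1.2)] -/
theorem locallyIntegrableOn_normSq_physVelocity
    (hu2 : LocallyIntegrable (fun z : ℝ × EuclideanSpace ℝ (Fin 3) => ‖uncurry u z‖ ^ 2) volume) :
    LocallyIntegrableOn (fun z : ℝ × EuclideanSpace ℝ (Fin 3) => ‖uncurry (physVelocity u) z‖ ^ 2)
      ((slab (EuclideanSpace ℝ (Fin 3)) (Ioi 0) isOpen_Ioi : Opens (ℝ × EuclideanSpace ℝ (Fin 3))) :
        Set (ℝ × EuclideanSpace ℝ (Fin 3))) volume := by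
  have hc : ContinuousOn (fun z : ℝ × EuclideanSpace ℝ (Fin 3) => (2 * z.1)⁻¹)
      (Ioi (0 : ℝ) ×ˢ univ) := by
    refine ContinuousOn.inv₀ (by fun_prop) fun z hz => ?_
    nlinarith [mem_Ioi.1 (mem_prod.1 hz).1]
  have h := locallyIntegrableOn_slab_smul_comp_simInv hu2 hc
  rw [coe_slab]
  refine locallyIntegrableOn_congr_eqOn (Q := slab (EuclideanSpace ℝ (Fin 3)) (Ioi 0) isOpen_Ioi) h
    fun z hz => ?_
  have ht : 0 < z.1 := (mem_prod.1 hz).1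
  have h2t : 0 ≤ 2 * z.1 := by linarith
  show (2 * z.1)⁻¹ • ‖uncurry u (simInv z)‖ ^ 2 = ‖uncurry (physVelocity u) z‖ ^ 2
  rw [uncurry_physVelocity_of_pos u ht, norm_smul, mul_pow, Real.norm_eq_abs, abs_inv,
    abs_of_nonneg (Real.sqrt_nonneg _), inv_pow, Real.sq_sqrt h2t, smul_eq_mul]

/-- **`π ∈ L¹_loc` on the slab** from `p ∈ L¹_loc(ℝ × ℝ³)` (`π(z) = (2t)⁻¹ p(Φ⁻¹z)`). [cite: BradshawTsai2017AHP, §4 (proof of Thm 1.2)] -/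
theorem locallyIntegrableOn_uncurry_physPressure
    (hp : LocallyIntegrable (uncurry p) volume) :
    LocallyIntegrableOn (uncurry (physPressure p))
      ((slab (EuclideanSpace ℝ (Fin 3)) (Ioi 0) isOpen_Ioi : Opens (ℝ × EuclideanSpace ℝ (Fin 3))) :
        Set (ℝ × EuclideanSpace ℝ (Fin 3))) volume := by
  have hc : ContinuousOn (fun z : ℝ × EuclideanSpace ℝ (Fin 3) => (2 * z.1)⁻¹)
      (Ioi (0 : ℝ) ×ˢ univ) := by
    refine ContinuousOn.inv₀ (by fun_prop) fun z hz => ?_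
    nlinarith [mem_Ioi.1 (mem_prod.1 hz).1]
  have h := locallyIntegrableOn_slab_smul_comp_simInv hp hc
  rw [coe_slab]
  exact locallyIntegrableOn_congr_eqOn (Q := slab (EuclideanSpace ℝ (Fin 3)) (Ioi 0) isOpen_Ioi) h
    fun z hz => (uncurry_physPressure_of_pos p (mem_prod.1 hz).1).symm

end Classes

/-! ### Weak divergence-freeness and the momentum equation on the slab -/

section Equations

/-- **`v` is weakly divergence free on the slab** ([BT1] Def. 2.2: "`u` is divergence free";
§4: the ansatz): for a scalar test `θ ∈ C_c^∞((0,∞) × ℝ³)`, `∫∫ v·∇θ dx dt = ∫ e^{3s} (∫ u(s)·∇_y(θ ∘ Φ)(s) dy) ds = 0`,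
the inner integrals vanishing for a.e. `s` by `∇·u(s) = 0` (Fubini: `u·∇(θ∘Φ)` is integrable). [cite: BradshawTsai2017AHP, Def. 2.2 and §4 (proof of Thm 1.2)] -/
theorem IsSuitablePeriodicWeakSolution.integral_inner_physVelocity_gradient_eq_zero
    (hS : IsSuitablePeriodicWeakSolution T U₀ u p) {θ : ℝ → EuclideanSpace ℝ (Fin 3) → ℝ}
    (hθ : IsSpaceTimeTestOn (slab (EuclideanSpace ℝ (Fin 3)) (Ioi 0) isOpen_Ioi) θ) :
    ∫ z in ((slab (EuclideanSpace ℝ (Fin 3)) (Ioi 0) isOpen_Ioi :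
        Opens (ℝ × EuclideanSpace ℝ (Fin 3))) : Set (ℝ × EuclideanSpace ℝ (Fin 3))),
      ⟪physVelocity u z.1 z.2, gradient (θ z.1) z.2⟫ = 0 := by
  rw [coe_slab, integral_slab_eq_integral_simMap]
  have hθ' : IsSpaceTimeTestOn (⊤ : Opens (ℝ × EuclideanSpace ℝ (Fin 3))) (simPull θ) := hθ.simPull
  have key : ∀ z : ℝ × EuclideanSpace ℝ (Fin 3),
      (simDensity (EuclideanSpace ℝ (Fin 3)) z : ℝ) •
          ⟪physVelocity u (simMap z).1 (simMap z).2, gradient (θ (simMap z).1) (simMap z).2⟫ =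
        ⟪u z.1 z.2, Real.exp (3 * z.1) • gradient (simPull θ z.1) z.2⟫ := by
    rintro ⟨s, y⟩
    rw [simMap_apply]
    dsimp only
    have h5 : Real.exp (5 * s) = Real.exp s ^ 5 := by rw [← Real.exp_nat_mul]; norm_num
    have h3 : Real.exp (3 * s) = Real.exp s ^ 3 := by rw [← Real.exp_nat_mul]; norm_num
    rw [physVelocity_simMap, gradient_simPull, coe_simDensity_three, smul_eq_mul,
      real_inner_smul_left, real_inner_smul_right, real_inner_smul_right, h5, h3]
    have hE : Real.exp s ≠ 0 := (Real.exp_pos s).ne'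
    field_simp
  have e : (fun z : ℝ × EuclideanSpace ℝ (Fin 3) => (simDensity (EuclideanSpace ℝ (Fin 3)) z : ℝ) •
      ⟪physVelocity u (simMap z).1 (simMap z).2, gradient (θ (simMap z).1) (simMap z).2⟫) =
      fun z => ⟪u z.1 z.2, Real.exp (3 * z.1) • gradient (simPull θ z.1) z.2⟫ := funext key
  rw [e]
  -- Fubini
  obtain ⟨hcg, -, hg0⟩ := hθ'.continuous_gradient_field
  have hint : Integrable (fun z : ℝ × EuclideanSpace ℝ (Fin 3) =>
      ⟪u z.1 z.2, Real.exp (3 * z.1) • gradient (simPull θ z.1) z.2⟫) volume :=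
    integrable_inner_of_locallyIntegrableOn (Q := ⊤) (u := u)
      (w := fun z => Real.exp (3 * z.1) • gradient (simPull θ z.1) z.2)
      (hS.locallyIntegrable_uncurry.locallyIntegrableOn _)
      ((Real.continuous_exp.comp (continuous_const.mul continuous_fst)).smul hcg)
      hθ'.hasCompactSupport (fun _ _ => trivial) fun z hz => by
        show Real.exp (3 * z.1) • gradient (simPull θ z.1) z.2 = 0
        rw [hg0 z hz, smul_zero]
  rw [Measure.volume_eq_prod] at hint
  rw [Measure.volume_eq_prod, integral_prod _ hint]
  have hae : ∀ᵐ s : ℝ, ∫ y, ⟪u (s, y).1 (s, y).2,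
      Real.exp (3 * (s, y).1) • gradient (simPull θ (s, y).1) (s, y).2⟫ = 0 := by
    filter_upwards [hS.divFree] with s hs
    have h1 := hs (simPull θ s) (hθ'.slice_isTestFunctionOn_top s)
    simp_rw [real_inner_smul_right]
    rw [integral_const_mul, h1, mul_zero]
  rw [integral_congr_ae hae, integral_zero]

/-- **`(v, π)` solves the momentum equation in the sense of distributions on the slab** ([BT1] §4
¶1): for `ζ ∈ C_c^∞((0,∞) × ℝ³; ℝ³)`,
`∫∫ (v·∂ₜζ + v·(v·∇)ζ + v·Δζ + π div ζ) dx dt = 0`, because after the change of variables the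
integrand is the one of the distributional Leray system (2.1) tested with `f = e^{2s} ζ ∘ Φ`
(`simDensity_mul_nse_integrand`). [cite: BradshawTsai2017AHP, §4 (proof of Thm 1.2) ¶1] -/
theorem IsSuitablePeriodicWeakSolution.integral_nse_phys_eq_zero
    (hS : IsSuitablePeriodicWeakSolution T U₀ u p)
    {ζ : ℝ → EuclideanSpace ℝ (Fin 3) → EuclideanSpace ℝ (Fin 3)}
    (hζ : IsSpaceTimeTestOn (slab (EuclideanSpace ℝ (Fin 3)) (Ioi 0) isOpen_Ioi) ζ) :
    ∫ z in ((slab (EuclideanSpace ℝ (Fin 3)) (Ioi 0) isOpen_Ioi :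
        Opens (ℝ × EuclideanSpace ℝ (Fin 3))) : Set (ℝ × EuclideanSpace ℝ (Fin 3))),
      (⟪physVelocity u z.1 z.2, timeDeriv ζ z.1 z.2⟫ +
        ⟪physVelocity u z.1 z.2, convect (physVelocity u z.1) (ζ z.1) z.2⟫ +
        1 * ⟪physVelocity u z.1 z.2, (Δ (ζ z.1)) z.2⟫ +
        physPressure p z.1 z.2 * VectorCalculus.divergence (ζ z.1) z.2 +
        ⟪(0 : ℝ → EuclideanSpace ℝ (Fin 3) → EuclideanSpace ℝ (Fin 3)) z.1 z.2, ζ z.1 z.2⟫) = 0 := by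
  rw [coe_slab, integral_slab_eq_integral_simMap]
  have key : ∀ z : ℝ × EuclideanSpace ℝ (Fin 3),
      (simDensity (EuclideanSpace ℝ (Fin 3)) z : ℝ) •
          (⟪physVelocity u (simMap z).1 (simMap z).2, timeDeriv ζ (simMap z).1 (simMap z).2⟫ +
            ⟪physVelocity u (simMap z).1 (simMap z).2,
              convect (physVelocity u (simMap z).1) (ζ (simMap z).1) (simMap z).2⟫ +
            1 * ⟪physVelocity u (simMap z).1 (simMap z).2, (Δ (ζ (simMap z).1)) (simMap z).2⟫ +
            physPressure p (simMap z).1 (simMap z).2 *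
              VectorCalculus.divergence (ζ (simMap z).1) (simMap z).2 +
            ⟪(0 : ℝ → EuclideanSpace ℝ (Fin 3) → EuclideanSpace ℝ (Fin 3)) (simMap z).1
              (simMap z).2, ζ (simMap z).1 (simMap z).2⟫) =
        ⟪u z.1 z.2, timeDeriv (fun s y => Real.exp (2 * s) • simPull ζ s y) z.1 z.2⟫ +
          ⟪u z.1 z.2, (Δ ((fun s y => Real.exp (2 * s) • simPull ζ s y) z.1)) z.2⟫ -
          ⟪u z.1 z.2, (2 : ℝ) • (fun s y => Real.exp (2 * s) • simPull ζ s y) z.1 z.2 +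
            fderiv ℝ ((fun s y => Real.exp (2 * s) • simPull ζ s y) z.1) z.2 z.2⟫ +
          ⟪u z.1 z.2, convect (u z.1) ((fun s y => Real.exp (2 * s) • simPull ζ s y) z.1) z.2⟫ +
          p z.1 z.2 *
            VectorCalculus.divergence ((fun s y => Real.exp (2 * s) • simPull ζ s y) z.1) z.2 := by
    rintro ⟨s, y⟩
    rw [simMap_apply]
    dsimp only
    rw [smul_eq_mul]
    exact simDensity_mul_nse_integrand hζ u p s y
  have e := funext key
  rw [e]
  exact hS.distributional _ (isSpaceTimeTestOn_expTwo_smul_simPull hζ)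

/-- **[BT1] §4 ¶1: `(v, π)` is a distributional solution of Navier–Stokes on the slab `t > 0`**
(`ν = 1`, `f = 0`; the tree's `IsDistributionalNSSolutionOn`): local integrability of `v`, `|v|²`,
`π` on the slab, weak divergence-freeness, and the momentum equation in the sense of
distributions. [cite: BradshawTsai2017AHP, §4 (proof of Thm 1.2) ¶1] -/
theorem IsSuitablePeriodicWeakSolution.isDistributionalNSSolutionOn_phys
    (hS : IsSuitablePeriodicWeakSolution T U₀ u p) (hU : Continuous (uncurry U₀)) :
    IsDistributionalNSSolutionOn (slab (EuclideanSpace ℝ (Fin 3)) (Ioi 0) isOpen_Ioi) 1 0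
      (physVelocity u) (physPressure p) :=
  ⟨locallyIntegrableOn_uncurry_physVelocity hS.locallyIntegrable_uncurry,
    locallyIntegrableOn_normSq_physVelocity (hS.locallyIntegrable_norm_sq hU),
    locallyIntegrableOn_uncurry_physPressure hS.locallyIntegrable_pressure,
    fun _ hθ => hS.integral_inner_physVelocity_gradient_eq_zero hθ,
    fun _ hζ => hS.integral_nse_phys_eq_zero hζ⟩

end Equations

/-! ### The energy class and the pressure class on the slab -/

section LocalClasses

/-- The profile's physical image `V₀ = physVelocity U₀` is continuous on the slab when `U₀` is
continuous. [folklore] -/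
theorem continuousOn_uncurry_physVelocity (hU : Continuous (uncurry U₀)) :
    ContinuousOn (uncurry (physVelocity U₀)) (Ioi (0 : ℝ) ×ˢ (univ : Set (EuclideanSpace ℝ (Fin 3)))) := by
  have hc : ContinuousOn (fun z : ℝ × EuclideanSpace ℝ (Fin 3) => (Real.sqrt (2 * z.1))⁻¹)
      (Ioi (0 : ℝ) ×ˢ univ) := by
    refine ContinuousOn.inv₀ (by fun_prop) fun z hz => ?_
    exact (Real.sqrt_pos.2 (by nlinarith [mem_Ioi.1 (mem_prod.1 hz).1])).ne'
  have h2 : ContinuousOn (fun z : ℝ × EuclideanSpace ℝ (Fin 3) =>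
      (Real.sqrt (2 * z.1))⁻¹ • uncurry U₀ (simInv z)) (Ioi (0 : ℝ) ×ˢ univ) :=
    hc.smul (hU.comp_continuousOn (continuousOn_simInv.mono fun z hz => hz)
      |>.congr fun z _ => rfl)
  exact h2.congr fun z hz => uncurry_physVelocity_of_pos U₀ (mem_prod.1 hz).1

/-- **The energy class `v ∈ L^∞_t L²_x` on compact subsets of the slab** ([BT1] Def. 2.2,
`u − U₀ ∈ L^∞(0,T;L²)`, transported): for a compact `K` in the slab (times in `(0, T')`, space in
`B_R`), and every `t`, `∫ 𝟙_K |v(t)|² dx ≤ 2√(2T') sup_s ‖u(s) − U₀(s)‖²_{L²} + 2 |B_R| sup_K |V₀|²`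
(`|v|² ≤ 2|v − V₀|² + 2|V₀|²`, `∫|v(t) − V₀(t)|² = √(2t) ∫|u(σ(t)) − U₀(σ(t))|²`, `V₀ = physVelocity U₀`
continuous on the slab). [cite: BradshawTsai2017AHP, Def. 2.2 and §4 (proof of Thm 1.2)] -/
theorem IsSuitablePeriodicWeakSolution.energyClass_phys
    (hS : IsSuitablePeriodicWeakSolution T U₀ u p) (hU : Continuous (uncurry U₀))
    (K : Set (ℝ × EuclideanSpace ℝ (Fin 3)))
    (hK : K ⊆ ((slab (EuclideanSpace ℝ (Fin 3)) (Ioi 0) isOpen_Ioi :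
      Opens (ℝ × EuclideanSpace ℝ (Fin 3))) : Set (ℝ × EuclideanSpace ℝ (Fin 3))))
    (hKc : IsCompact K) :
    ∃ C : ℝ≥0, ∀ᵐ t : ℝ, ∫⁻ x, K.indicator
      (fun z : ℝ × EuclideanSpace ℝ (Fin 3) => ‖physVelocity u z.1 z.2‖ₑ ^ 2) (t, x) ≤ C := by
  obtain ⟨T', R, hTR⟩ := BradshawTsai2019.exists_bounds_of_isCompact_subset_slab hK hKc
  obtain ⟨C, hC⟩ := hS.energy
  have hK' : K ⊆ Ioi (0 : ℝ) ×ˢ (univ : Set (EuclideanSpace ℝ (Fin 3))) := hK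
  obtain ⟨M, hM⟩ := hKc.exists_bound_of_continuousOn ((continuousOn_uncurry_physVelocity hU).mono hK')
  have hfin : 2 * (ENNReal.ofReal (Real.sqrt (2 * T')) * C) +
      2 * (ENNReal.ofReal M ^ 2 * volume (ball (0 : EuclideanSpace ℝ (Fin 3)) R)) ≠ ∞ :=
    ENNReal.add_ne_top.2 ⟨ENNReal.mul_ne_top ENNReal.ofNat_ne_top
      (ENNReal.mul_ne_top ENNReal.ofReal_ne_top ENNReal.coe_ne_top),
      ENNReal.mul_ne_top ENNReal.ofNat_ne_top (ENNReal.mul_ne_top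
        (ENNReal.pow_ne_top ENNReal.ofReal_ne_top) measure_ball_lt_top.ne)⟩
  refine ⟨(2 * (ENNReal.ofReal (Real.sqrt (2 * T')) * C) +
    2 * (ENNReal.ofReal M ^ 2 * volume (ball (0 : EuclideanSpace ℝ (Fin 3)) R))).toNNReal,
    Eventually.of_forall fun t => ?_⟩
  rw [ENNReal.coe_toNNReal hfin]
  by_cases hne : ∃ x, (t, x) ∈ K
  · obtain ⟨x₀, hx₀⟩ := hne
    have ht : 0 < t := (hTR _ hx₀).1
    have htT : t < T' := (hTR _ hx₀).2.1
    have hpt : ∀ x, K.indicator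
        (fun z : ℝ × EuclideanSpace ℝ (Fin 3) => ‖physVelocity u z.1 z.2‖ₑ ^ 2) (t, x) ≤
        2 * ‖physVelocity u t x - physVelocity U₀ t x‖ₑ ^ 2 +
          (ball (0 : EuclideanSpace ℝ (Fin 3)) R).indicator
            (fun _ => 2 * ENNReal.ofReal M ^ 2) x := by
      intro x
      by_cases hx : (t, x) ∈ K
      · have hxR : x ∈ ball (0 : EuclideanSpace ℝ (Fin 3)) R := by
          rw [mem_ball, dist_zero_right]; exact (hTR _ hx).2.2
        rw [indicator_of_mem hx, indicator_of_mem hxR]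
        have h2 : ‖physVelocity U₀ t x‖ₑ ≤ ENNReal.ofReal M := by
          rw [← ofReal_norm]; exact ENNReal.ofReal_le_ofReal (hM (t, x) hx)
        calc ‖physVelocity u t x‖ₑ ^ 2
            ≤ 2 * ‖physVelocity u t x - physVelocity U₀ t x‖ₑ ^ 2 +
                2 * ‖physVelocity U₀ t x‖ₑ ^ 2 :=
              BradshawTsai2019.enorm_sq_le_two_mul_sub_sq_add _ _
          _ ≤ 2 * ‖physVelocity u t x - physVelocity U₀ t x‖ₑ ^ 2 + 2 * ENNReal.ofReal M ^ 2 := by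
              gcongr
      · rw [indicator_of_notMem hx]; exact zero_le
    have hgm : AEMeasurable (fun x : EuclideanSpace ℝ (Fin 3) =>
        (ball (0 : EuclideanSpace ℝ (Fin 3)) R).indicator (fun _ => 2 * ENNReal.ofReal M ^ 2) x)
        volume :=
      (measurable_const.indicator measurableSet_ball).aemeasurable
    calc ∫⁻ x, K.indicator
          (fun z : ℝ × EuclideanSpace ℝ (Fin 3) => ‖physVelocity u z.1 z.2‖ₑ ^ 2) (t, x)
        ≤ ∫⁻ x, (2 * ‖physVelocity u t x - physVelocity U₀ t x‖ₑ ^ 2 +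
            (ball (0 : EuclideanSpace ℝ (Fin 3)) R).indicator
              (fun _ => 2 * ENNReal.ofReal M ^ 2) x) := lintegral_mono hpt
      _ = 2 * (∫⁻ x, ‖physVelocity u t x - physVelocity U₀ t x‖ₑ ^ 2) +
            2 * ENNReal.ofReal M ^ 2 * volume (ball (0 : EuclideanSpace ℝ (Fin 3)) R) := by
          rw [lintegral_add_right' _ hgm, lintegral_const_mul' _ _ ENNReal.ofNat_ne_top,
            lintegral_indicator_const measurableSet_ball]
      _ ≤ 2 * (ENNReal.ofReal (Real.sqrt (2 * T')) * C) +
            2 * (ENNReal.ofReal M ^ 2 * volume (ball (0 : EuclideanSpace ℝ (Fin 3)) R)) := by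
          have e : (fun x => ‖physVelocity u t x - physVelocity U₀ t x‖ₑ ^ 2) =
              fun x => ‖physVelocity (fun s y => u s y - U₀ s y) t x‖ₑ ^ 2 := by
            funext x; rw [physVelocity_sub]
          rw [e, lintegral_enorm_sq_physVelocity _ ht, mul_assoc]
          have h1 : ENNReal.ofReal (Real.sqrt (2 * t)) ≤ ENNReal.ofReal (Real.sqrt (2 * T')) :=
            ENNReal.ofReal_le_ofReal (Real.sqrt_le_sqrt (by linarith))
          have h2 : ∫⁻ y, ‖(fun s y => u s y - U₀ s y) (simTimeInv t) y‖ₑ ^ 2 ≤ C := hC _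
          exact add_le_add (mul_le_mul' le_rfl (mul_le_mul' h1 h2)) le_rfl
  · have h0 : (fun x => K.indicator
        (fun z : ℝ × EuclideanSpace ℝ (Fin 3) => ‖physVelocity u z.1 z.2‖ₑ ^ 2) (t, x)) =
        fun _ => 0 := by
      funext x
      exact indicator_of_notMem (fun h => hne ⟨x, h⟩) _
    rw [h0, lintegral_zero]
    exact zero_le

/-- **The pressure class `π ∈ L^{3/2}_loc` on the slab** ([BT1] Def. 2.3: `p ∈ L^{3/2}_loc(ℝ⁴)`,
transported): on a compact `K` in the slab, `∫_K |π|^{3/2} = ∫_{Φ⁻¹K} e^{5s} e^{-3s} |p|^{3/2} ≤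
e^{2 s_max} ∫_{Φ⁻¹K} |p|^{3/2} < ∞` (`Φ⁻¹K` is compact). [cite: BradshawTsai2017AHP, Def. 2.3 and §4 (proof of Thm 1.2)] -/
theorem IsSuitablePeriodicWeakSolution.pressure_threeHalves_phys
    (hS : IsSuitablePeriodicWeakSolution T U₀ u p) (K : Set (ℝ × EuclideanSpace ℝ (Fin 3)))
    (hK : K ⊆ ((slab (EuclideanSpace ℝ (Fin 3)) (Ioi 0) isOpen_Ioi :
      Opens (ℝ × EuclideanSpace ℝ (Fin 3))) : Set (ℝ × EuclideanSpace ℝ (Fin 3))))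
    (hKc : IsCompact K) :
    ∫⁻ z in K, ‖physPressure p z.1 z.2‖ₑ ^ (3 / 2 : ℝ) < ∞ := by
  have hK' : K ⊆ Ioi (0 : ℝ) ×ˢ (univ : Set (EuclideanSpace ℝ (Fin 3))) := hK
  have hKi : K ∩ Ioi (0 : ℝ) ×ˢ (univ : Set (EuclideanSpace ℝ (Fin 3))) = K := inter_eq_left.2 hK'
  have hcov := setLIntegral_inter_slab_eq_simMap
    (fun z : ℝ × EuclideanSpace ℝ (Fin 3) => ‖physPressure p z.1 z.2‖ₑ ^ (3 / 2 : ℝ))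
    hKc.measurableSet
  rw [hKi] at hcov
  rw [hcov]
  have h32 : (0 : ℝ) ≤ 3 / 2 := by norm_num
  have key : ∀ z : ℝ × EuclideanSpace ℝ (Fin 3),
      (simDensity (EuclideanSpace ℝ (Fin 3)) z : ℝ≥0∞) *
          ‖physPressure p (simMap z).1 (simMap z).2‖ₑ ^ (3 / 2 : ℝ) =
        ENNReal.ofReal (Real.exp (2 * z.1)) * ‖p z.1 z.2‖ₑ ^ (3 / 2 : ℝ) := by
    rintro ⟨s, y⟩
    rw [simMap_apply, physPressure_simMap, enorm_mul, ENNReal.mul_rpow_of_nonneg _ _ h32,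
      ← mul_assoc, ← ENNReal.ofReal_coe_nnreal, coe_simDensity_three,
      Real.enorm_eq_ofReal (inv_nonneg.2 (Real.exp_pos _).le),
      ENNReal.ofReal_rpow_of_nonneg (inv_nonneg.2 (Real.exp_pos _).le) h32,
      ← ENNReal.ofReal_mul (Real.exp_pos _).le]
    congr 2
    simp only
    rw [← Real.exp_neg, ← Real.exp_mul, ← Real.exp_add]
    congr 1
    ring
  simp_rw [key]
  have hKp : IsCompact ((simMap : ℝ × EuclideanSpace ℝ (Fin 3) → ℝ × EuclideanSpace ℝ (Fin 3)) ⁻¹' K) :=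
    isCompact_preimage_simMap hKc hK'
  obtain ⟨B, hB⟩ := hKp.exists_bound_of_continuousOn
    ((Real.continuous_exp.comp (continuous_const.mul continuous_fst)).continuousOn :
      ContinuousOn (fun z : ℝ × EuclideanSpace ℝ (Fin 3) => Real.exp (2 * z.1)) _)
  calc ∫⁻ z in simMap ⁻¹' K, ENNReal.ofReal (Real.exp (2 * z.1)) * ‖p z.1 z.2‖ₑ ^ (3 / 2 : ℝ)
      ≤ ∫⁻ z in simMap ⁻¹' K, ENNReal.ofReal B * ‖p z.1 z.2‖ₑ ^ (3 / 2 : ℝ) := by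
        refine setLIntegral_mono' hKp.measurableSet fun z hz => ?_
        refine mul_le_mul' (ENNReal.ofReal_le_ofReal ?_) le_rfl
        exact (le_abs_self _).trans ((Real.norm_eq_abs _).symm.le.trans (hB z hz))
    _ = ENNReal.ofReal B * ∫⁻ z in simMap ⁻¹' K, ‖p z.1 z.2‖ₑ ^ (3 / 2 : ℝ) :=
        lintegral_const_mul' _ _ ENNReal.ofReal_ne_top
    _ < ∞ := ENNReal.mul_lt_top ENNReal.ofReal_lt_top (hS.pressure_threeHalves _ hKp)

end LocalClasses

end BradshawTsai2017

end Literature.Analysis.FluidPDE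

end
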